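import Summits.HodgeConjecture.CorCM.CMEllipticCurveTimesSimpleCMThreefold
import Summits.HodgeConjecture.CorCM.QuadraticSubfieldFibres
import HarnessLib

/-!
# The Weil classes of `k` on `E × T` itself: an embedding `k ↪ K` puts an exceptional rational `(2,2)`-class on the
# product of a CM elliptic curve with a simple CM threefold — `D²(E × T) ≠ B²(E × T)` (Moonen–Zarhin (0.2) (1))

COR-CM (cell `pub-hodgecm2`, binder seat `b16` gen 37, count-neutral claim FOREIGN-IQ (F4b)); NEW as stated, hence under
`Summits/`.  Theorems only; no definition, no named fact, no `sorry`.

`CorCM/CMEllipticCurveTimesSimpleCMThreefold` (F3) proves Moonen–Zarhin's dichotomy for `X = E × T` in the CM case with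
the exceptional class placed on SOME product `E^m × T^n` (Hazama–Murty).  [MoonenZarhin1999LowDim, Thm. (0.2) (1)] is
sharper in case (a): the Hodge ring of `X` itself is generated by divisors and the Weil classes `W_k ⊂ B²(X)`, and "the
Weil classes are really needed … `D²(X) ≠ B²(X)`".  This file proves that sharper clause, in Pohlmann's coordinates
(`Pohlmann1968/DivisorClassesCMAlgebra.exists_exceptional_biproduct_iff`: a product of realisations carries a rational
`(m,m)`-class outside `Dᵐ ⊗ ℂ` iff some Galois-balanced `2m`-set of slot-embeddings is not a disjoint union of balanced
pairs), by exhibiting the WEIL FIBRE.  Data: a separating family `(K_i; Φ_i)`, a product `⨁_{j<N} A_{π j}` of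
realisations, a slot `j₀` with `[K_{π j₀} : ℚ] = 2` (the curve `E`, `k = K_{π j₀}`), a slot `j₁` with `[K_{π j₁} : ℚ] = 6`
and `Φ_{π j₁}` nondegenerate (the simple threefold `T`, `K = K_{π j₁}`), and `e : k →+* K`.

* §1 = `CorCM/QuadraticSubfieldFibres` (this seat): the fibres of `Hom(K, ℂ) → Hom(k, ℂ)` have `3` elements, and a
  nondegenerate `Φ_{π j₁}` meets the fibre of one of `ψ₀, ψ̄₀` in exactly `n(ψ) = 1` element (multiplicities `(2,1)`).
* §2 the Weil fibre weight `S = {(j₀, ψ₀)} ⊔ {(j₁, s) | s ∘ e = ψ}` with `ψ₀ ∈ Φ_{π j₀}` and `n(ψ) = 1`: `|S| = 4`; for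
  `τ ∈ Aut(ℂ)` fixing `k`, `τ` permutes the fibre and `#{x ∈ S | τx ∈ Φ} = 1 + n(ψ) = 2`; for `τ` conjugating `k`, `τ` maps
  the fibre of `ψ` onto that of `ψ̄` and `#{x ∈ S | τx ∈ Φ} = 0 + n(ψ̄) = 2`: `S` is Galois balanced
  (**`weilFibre_mem_pohlmannSetsAlg_two`**); its multiplicity function is not conjugation invariant at `(π j₀, ψ₀)`, so `S`
  is not a disjoint union of balanced pairs (**`weilFibre_not_mem_pohlmannDivisorSetsAlg`**, via the tree's
  `famMult_conj_of_mem_pohlmannDivisorSetsAlg` for separating families) — the multiplicities `(2, 2)` of `k` on `T_{X,0}`.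
* §3 **`exists_exceptional_two_prod_of_ringHom`** — every product `⨁_{j<N} A_{π j}` with a curve slot and a threefold slot
  linked by `e : k ↪ K` carries a rational `(2,2)`-class OUTSIDE `D² ⊗ ℂ`; **`hodgeClassSpan_two_ne_divisorClassesSpan_of_ringHom`**
  — `B² ⊗ ℂ ≠ D² ⊗ ℂ` there; **`exists_exceptional_two_curve_threefold_of_ringHom`** — the literal `X = E × T`
  (`N = 2`): `D²(X) ≠ B²(X)`, for `T` a SIMPLE CM threefold whose sextic CM field receives the CM field of `E`.

## References

* [MoonenZarhin1999LowDim] B. Moonen, Yu. Zarhin, Math. Ann. 315 (1999) 711–733, Thm. (0.2) (a) and (1) ("in the cases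
  (a), (b) and (c) the Weil classes are really needed … `D²(X) ≠ B²(X)`"), (1.9), Criterion 13 of [MZ Duke 1995].
* [Gordon1999HodgeAVSurvey] B. B. Gordon, *A survey of the Hodge conjecture for abelian varieties*, §9.2 (9.2.1)–9.2.2.
* [Deligne1982HodgeCycles] P. Deligne, LNM 900, §4 (Weil classes), Prop. 4.4.
-/

noncomputable section

open CategoryTheory CategoryTheory.Limits NumberField NumberField.ComplexEmbedding
open scoped BigOperators

namespace Summit.HodgeConjecture.CorCM

open Literature.NumberTheory.ComplexMultiplication
open Literature.AlgebraicGeometry.Motives (AbelianVariety CMType)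
open Literature.AlgebraicGeometry.HodgeTheory
open Literature.AlgebraicGeometry.ComplexMultiplication (IsCMTypeRealisation isSimple_iff_isPrimitive)
open Literature.AlgebraicGeometry.VanGeemen1994 (hodgeClassSpan)
open Literature.AlgebraicGeometry.Pohlmann1968
open Literature.Barriers.HodgeConjecture (divisorClassesSpan)

/-! ## §2 The Weil fibre weight on a product `⨁_{j<N} A_{π j}` -/

section Weight

open scoped Classical

variable {I : Type} {K : I → Type} [∀ i, Field (K i)] [∀ i, NumberField (K i)] [∀ i, IsCMField (K i)]
  {Φ : ∀ i, CMType (K i)} {N : ℕ}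

omit [∀ i, IsCMField (K i)] in
/-- A curve slot and a threefold slot are different slots. [folklore] -/
private theorem slot_ne_of_finrank (π : Fin N → I) {j₀ j₁ : Fin N} (h2 : Module.finrank ℚ (K (π j₀)) = 2)
    (h6 : Module.finrank ℚ (K (π j₁)) = 6) : π j₁ ≠ π j₀ := by
  intro h
  have := congrArg (fun i => Module.finrank ℚ (K i)) h
  simp only [h2, h6] at this
  omega

/-- **The Weil fibre weight is Galois balanced** (`S = {(j₀, ψ₀)} ⊔ {(j₁, s) | s ∘ e = ψ}` with `ψ₀ ∈ Φ_{π j₀}` and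
`n(ψ) = #{s ∈ Φ_{π j₁} | s ∘ e = ψ} = 1` lies in `pohlmannSetsAlg 2`): `|S| = 4`, and for `τ ∈ Aut(ℂ)` either `τ`
fixes `Hom(k, ℂ)` — then `#{x ∈ S | τx ∈ Φ} = [ψ₀ ∈ Φ] + n(ψ) = 2` — or `τ` is conjugation there — then
`#{x ∈ S | τx ∈ Φ} = [ψ̄₀ ∈ Φ] + n(ψ̄) = 0 + 2`: the index of a generator of the Weil plane of `k` acting on `E × T`
with multiplicities `(2, 2)`. [cite: MoonenZarhin1999LowDim, Thm. (0.2) (a) and (1.9)] [cite: Gordon1999HodgeAVSurvey, §9.2 (9.2.1)] -/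
theorem weilFibre_mem_pohlmannSetsAlg_two (π : Fin N → I) {j₀ j₁ : Fin N} (h2 : Module.finrank ℚ (K (π j₀)) = 2)
    (h6 : Module.finrank ℚ (K (π j₁)) = 6) (e : K (π j₀) →+* K (π j₁)) {ψ₀ : K (π j₀) →+* ℂ}
    (hψ₀ : ψ₀ ∈ (Φ (π j₀)).1) {ψ : K (π j₀) →+* ℂ}
    (hn : (Finset.univ.filter fun s : K (π j₁) →+* ℂ => s.comp e = ψ ∧ s ∈ (Φ (π j₁)).1).card = 1) :
    insert (⟨j₀, ψ₀⟩ : (j : Fin N) × (K (π j) →+* ℂ))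
        ((Finset.univ.filter fun s : K (π j₁) →+* ℂ => s.comp e = ψ).map ⟨Sigma.mk j₁, sigma_mk_injective⟩) ∈
      pohlmannSetsAlg (K := fun j : Fin N => K (π j)) (fun j => Φ (π j)) 2 := by
  set T : Finset ((j : Fin N) × (K (π j) →+* ℂ)) :=
    (Finset.univ.filter fun s : K (π j₁) →+* ℂ => s.comp e = ψ).map ⟨Sigma.mk j₁, sigma_mk_injective⟩ with hT
  have hj : j₁ ≠ j₀ := fun h => slot_ne_of_finrank π h2 h6 (congrArg π h)
  have hx₀T : (⟨j₀, ψ₀⟩ : (j : Fin N) × (K (π j) →+* ℂ)) ∉ T := by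
    intro hx
    rw [hT, Finset.mem_map] at hx
    obtain ⟨s, -, hs⟩ := hx
    exact hj (Sigma.mk.inj_iff.1 hs).1
  have hcardT : T.card = 3 := by
    rw [hT, Finset.card_map, WeilFibre.card_fibre_eq_three (Φ (π j₀)) h2 h6 e ψ]
  have hCM : IsCMTypeWith (starRingAut : ℂ ≃+* ℂ) (Φ (π j₀)).1 := isCMTypeWith_conj (Φ (π j₀))
  have hc : Fintype.card (K (π j₀) →+* ℂ) = 2 := by rw [Embeddings.card, h2]
  refine ⟨by rw [Finset.card_insert_of_notMem hx₀T, hcardT], ?_⟩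
  refine (CMAlgebra.isGaloisBalancedAlg_slots_iff_two_mul Φ π _).2 fun τ => ?_
  rw [Finset.card_insert_of_notMem hx₀T, hcardT]
  -- the count as a filtered finset
  have hset : {x : (j : Fin N) × (K (π j) →+* ℂ) | x ∈ insert (⟨j₀, ψ₀⟩ : (j : Fin N) × (K (π j) →+* ℂ)) T ∧
        (τ : ℂ →+* ℂ).comp x.2 ∈ (Φ (π x.1)).1} =
      ↑((insert (⟨j₀, ψ₀⟩ : (j : Fin N) × (K (π j) →+* ℂ)) T).filter fun x => (τ : ℂ →+* ℂ).comp x.2 ∈ (Φ (π x.1)).1) := by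
    ext x
    simp only [Set.mem_setOf_eq, Finset.coe_filter]
  rw [hset, Set.ncard_coe_finset, Finset.filter_insert]
  -- the threefold part of the count: `n(τ ∘ ψ)`
  have hTcount : (T.filter fun x => (τ : ℂ →+* ℂ).comp x.2 ∈ (Φ (π x.1)).1).card =
      (Finset.univ.filter fun s : K (π j₁) →+* ℂ => s.comp e = (τ : ℂ →+* ℂ).comp ψ ∧ s ∈ (Φ (π j₁)).1).card := by
    rw [hT, Finset.filter_map, Finset.card_map, Finset.filter_filter]
    exact WeilFibre.card_fibre_comp_mem_eq e (Φ (π j₁)) ψ τ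
  have hx₀T' : (⟨j₀, ψ₀⟩ : (j : Fin N) × (K (π j) →+* ℂ)) ∉
      T.filter fun x => (τ : ℂ →+* ℂ).comp x.2 ∈ (Φ (π x.1)).1 := fun h => hx₀T (Finset.mem_filter.1 h).1
  have hsum := WeilFibre.card_fibre_mem_add (Φ (π j₀)) h2 h6 e (Φ (π j₁)) ψ
  rcases TwoSlot.forall_smul_eq_or_forall_smul_eq_rho_smul (G := ℂ ≃+* ℂ) (E := fun i => K i →+* ℂ)
    (Φ := fun i => (Φ i).1) (i := π j₀) hCM hc τ with hfix | hrho
  · -- `τ` fixes `Hom(k, ℂ)`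
    have h1 : (τ : ℂ →+* ℂ).comp ψ₀ = ψ₀ := hfix ψ₀
    have h2' : (τ : ℂ →+* ℂ).comp ψ = ψ := hfix ψ
    simp only [h1, hψ₀, if_true]
    rw [Finset.card_insert_of_notMem hx₀T', hTcount, h2', hn]
  · -- `τ` is complex conjugation on `Hom(k, ℂ)`
    have h1 : (τ : ℂ →+* ℂ).comp ψ₀ = conjugate ψ₀ := by rw [← conj_smul_eq_conjugate]; exact hrho ψ₀
    have h2' : (τ : ℂ →+* ℂ).comp ψ = conjugate ψ := by rw [← conj_smul_eq_conjugate]; exact hrho ψ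
    have hnot : conjugate ψ₀ ∉ (Φ (π j₀)).1 := ((Φ (π j₀)).2 ψ₀).1 hψ₀
    simp only [h1, hnot, if_false]
    rw [hTcount, h2']
    omega

/-- **The Weil fibre weight is not a disjoint union of balanced pairs**: for a SEPARATING family the multiplicity
function of a member of `pohlmannDivisorSetsAlg` is conjugation invariant (the tree's
`famMult_conj_of_mem_pohlmannDivisorSetsAlg`), but `S` has multiplicity `1` at `(π j₀, ψ₀)` and `0` at `(π j₀, ψ̄₀)`
(no other slot of `S` lies over the curve's field, of degree `2 ≠ 6`). [cite: Gordon1999HodgeAVSurvey, 9.2.2]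
[cite: MoonenZarhin1999LowDim, Thm. (0.2) (1)] -/
theorem weilFibre_not_mem_pohlmannDivisorSetsAlg [Fintype I] (hsep : CMAlgebra.IsSeparatingFamily Φ) (π : Fin N → I)
    {j₀ j₁ : Fin N} (h2 : Module.finrank ℚ (K (π j₀)) = 2) (h6 : Module.finrank ℚ (K (π j₁)) = 6)
    (e : K (π j₀) →+* K (π j₁)) (ψ₀ ψ : K (π j₀) →+* ℂ) :
    insert (⟨j₀, ψ₀⟩ : (j : Fin N) × (K (π j) →+* ℂ))
        ((Finset.univ.filter fun s : K (π j₁) →+* ℂ => s.comp e = ψ).map ⟨Sigma.mk j₁, sigma_mk_injective⟩) ∉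
      pohlmannDivisorSetsAlg (K := fun j : Fin N => K (π j)) (fun j => Φ (π j)) 2 := by
  intro hU
  have h := CMAlgebra.famMult_conj_of_mem_pohlmannDivisorSetsAlg hsep π hU ⟨π j₀, ψ₀⟩
  -- multiplicity `≥ 1` at `(π j₀, ψ₀)`
  have hpos : 0 < CMAlgebra.famMult π (insert (⟨j₀, ψ₀⟩ : (j : Fin N) × (K (π j) →+* ℂ))
      ((Finset.univ.filter fun s : K (π j₁) →+* ℂ => s.comp e = ψ).map ⟨Sigma.mk j₁, sigma_mk_injective⟩))
      ⟨π j₀, ψ₀⟩ := by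
    unfold CMAlgebra.famMult
    exact Finset.card_pos.2 ⟨⟨j₀, ψ₀⟩, Finset.mem_filter.2 ⟨Finset.mem_insert_self _ _, rfl⟩⟩
  -- multiplicity `0` at `(π j₀, ψ̄₀)`
  have hzero : CMAlgebra.famMult π (insert (⟨j₀, ψ₀⟩ : (j : Fin N) × (K (π j) →+* ℂ))
      ((Finset.univ.filter fun s : K (π j₁) →+* ℂ => s.comp e = ψ).map ⟨Sigma.mk j₁, sigma_mk_injective⟩))
      ⟨π j₀, conjugate ψ₀⟩ = 0 := by
    unfold CMAlgebra.famMult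
    refine Finset.card_eq_zero.2 (Finset.filter_eq_empty_iff.2 fun x hx hxy => ?_)
    rcases Finset.mem_insert.1 hx with rfl | hx
    · rw [CMAlgebra.slotProj_apply] at hxy
      exact conjugate_ne_self (Φ (π j₀)) ψ₀ (eq_of_heq (Sigma.mk.inj_iff.1 hxy).2).symm
    · obtain ⟨s, -, rfl⟩ := Finset.mem_map.1 hx
      rw [CMAlgebra.slotProj_apply] at hxy
      exact slot_ne_of_finrank π h2 h6 (Sigma.mk.inj_iff.1 hxy).1
  rw [hzero] at h
  exact (Nat.lt_irrefl 0) (h ▸ hpos)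

/-- **An exceptional weight in degree `4` on any product with a curve slot and a threefold slot linked by `k ↪ K`.**
[cite: MoonenZarhin1999LowDim, Thm. (0.2) (a) and (1)] -/
theorem exists_mem_pohlmannSetsAlg_two_diff_of_ringHom [Fintype I] (hsep : CMAlgebra.IsSeparatingFamily Φ)
    (π : Fin N → I) {j₀ j₁ : Fin N} (h2 : Module.finrank ℚ (K (π j₀)) = 2) (h6 : Module.finrank ℚ (K (π j₁)) = 6)
    (hnd : IsNondegenerate (Φ (π j₁))) (e : K (π j₀) →+* K (π j₁)) :
    (pohlmannSetsAlg (K := fun j : Fin N => K (π j)) (fun j => Φ (π j)) 2 \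
      pohlmannDivisorSetsAlg (K := fun j : Fin N => K (π j)) (fun j => Φ (π j)) 2).Nonempty := by
  have hCM : IsCMTypeWith (starRingAut : ℂ ≃+* ℂ) (Φ (π j₀)).1 := isCMTypeWith_conj (Φ (π j₀))
  have hc : Fintype.card (K (π j₀) →+* ℂ) = 2 := by rw [Embeddings.card, h2]
  obtain ⟨ψ₀, hψ₀⟩ := TwoSlot.exists_mem (G := ℂ ≃+* ℂ) (E := fun i => K i →+* ℂ) (Φ := fun i => (Φ i).1)
    (i := π j₀) hCM hc
  obtain ⟨ψ, -, hn⟩ := WeilFibre.exists_card_fibre_mem_eq_one (Φ (π j₀)) h2 h6 e hnd ψ₀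
  exact ⟨_, weilFibre_mem_pohlmannSetsAlg_two π h2 h6 e hψ₀ hn, weilFibre_not_mem_pohlmannDivisorSetsAlg hsep π h2 h6 e ψ₀ ψ⟩

end Weight

/-! ## §3 Exceptional `(2,2)`-classes on `E × T` and on every product containing both -/

section Geometry

variable {I : Type} {K : I → Type} [∀ i, Field (K i)] [∀ i, NumberField (K i)] [∀ i, IsCMField (K i)] [Fintype I]
  {Φ : ∀ i, CMType (K i)}
variable {A : I → AbelianVariety ℂ} {ι : ∀ i, 𝓞 (K i) →+* End (A i)}
  {θ : ∀ i, K i →+* Module.End ℂ (complexBetti (A i).X 1)}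

/-- **`D² ≠ B²` on every product with a curve slot `j₀` and a threefold slot `j₁` linked by `e : K_{π j₀} ↪ K_{π j₁}`**:
for a separating family of realisations (`Φ_{π j₁}` nondegenerate, e.g. a simple CM threefold), `⨁_{j<N} A_{π j}` carries
a rational `(2,2)`-class OUTSIDE `D² ⊗ ℂ` — the Weil classes of `k` on `E × T`, pulled back.
[cite: MoonenZarhin1999LowDim, Thm. (0.2) (a) and (1)] [cite: Gordon1999HodgeAVSurvey, 9.2.2] -/
theorem exists_exceptional_two_prod_of_ringHom (hsep : CMAlgebra.IsSeparatingFamily Φ)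
    (hA : ∀ i, IsCMTypeRealisation (Φ i) (A i) (ι i) (θ i)) {N : ℕ} (π : Fin N → I) {j₀ j₁ : Fin N}
    (h2 : Module.finrank ℚ (K (π j₀)) = 2) (h6 : Module.finrank ℚ (K (π j₁)) = 6) (hnd : IsNondegenerate (Φ (π j₁)))
    (e : K (π j₀) →+* K (π j₁)) :
    ∃ c : complexBetti (⨁ fun j : Fin N => A (π j)).X (2 * 2), IsRationalClass c ∧
      IsOfHodgeType (⨁ fun j : Fin N => A (π j)).dim (⨁ fun j : Fin N => A (π j)).X (2 * 2) 2 2 c ∧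
      c ∉ divisorClassesSpan (⨁ fun j : Fin N => A (π j)).X (⨁ fun j : Fin N => A (π j)).dim 2 :=
  (exists_exceptional_biproduct_iff (K := fun j : Fin N => K (π j)) (A := fun j => A (π j))
    (Φ := fun j => Φ (π j)) (ι := fun j => ι (π j)) (θ := fun j => θ (π j)) (fun j => hA (π j)) 2).2
    (exists_mem_pohlmannSetsAlg_two_diff_of_ringHom hsep π h2 h6 hnd e)

/-- **`B² ⊗ ℂ ≠ D² ⊗ ℂ`** on such a product. [cite: MoonenZarhin1999LowDim, Thm. (0.2) (1)] -/
theorem hodgeClassSpan_two_ne_divisorClassesSpan_of_ringHom (hsep : CMAlgebra.IsSeparatingFamily Φ)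
    (hA : ∀ i, IsCMTypeRealisation (Φ i) (A i) (ι i) (θ i)) {N : ℕ} (π : Fin N → I) {j₀ j₁ : Fin N}
    (h2 : Module.finrank ℚ (K (π j₀)) = 2) (h6 : Module.finrank ℚ (K (π j₁)) = 6) (hnd : IsNondegenerate (Φ (π j₁)))
    (e : K (π j₀) →+* K (π j₁)) :
    hodgeClassSpan (⨁ fun j : Fin N => A (π j)).dim (⨁ fun j : Fin N => A (π j)).X 2 ≠
      divisorClassesSpan (⨁ fun j : Fin N => A (π j)).X (⨁ fun j : Fin N => A (π j)).dim 2 := by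
  obtain ⟨c, hcQ, hcH, hcD⟩ := exists_exceptional_two_prod_of_ringHom hsep hA π h2 h6 hnd e
  exact fun h => hcD (h ▸ Submodule.subset_span ⟨hcQ, hcH⟩)

/-- **Moonen–Zarhin (0.2) (1) for `X = E × T`, CM case: `D²(X) ≠ B²(X)`.**  Pairwise non-isogenous CM elliptic curves
in the slots `a ≠ b` and ONE simple CM threefold `T = A_b` (`[K_b : ℚ] = 6`); if the field of the curve in slot `j₀`
embeds in `K_b` then EVERY product `⨁_{j<N} A_{π j}` through both slots carries an exceptional rational `(2,2)`-class.
[cite: MoonenZarhin1999LowDim, Thm. (0.2) (a) and (1)] -/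
theorem exists_exceptional_two_prod_of_ringHom_of_isSimple (b : I) (h2 : ∀ j, j ≠ b → Module.finrank ℚ (K j) = 2)
    (h6 : Module.finrank ℚ (K b) = 6) (hA : ∀ i, IsCMTypeRealisation (Φ i) (A i) (ι i) (θ i))
    (hni : ∀ i j, i ≠ b → j ≠ b → i ≠ j → ¬AbelianVariety.IsIsogenous (A i) (A j)) (hT : (A b).IsSimple)
    {N : ℕ} (π : Fin N → I) {j₀ j₁ : Fin N} (hj₀ : π j₀ ≠ b) (hj₁ : π j₁ = b) (e : K (π j₀) →+* K (π j₁)) :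
    ∃ c : complexBetti (⨁ fun j : Fin N => A (π j)).X (2 * 2), IsRationalClass c ∧
      IsOfHodgeType (⨁ fun j : Fin N => A (π j)).dim (⨁ fun j : Fin N => A (π j)).X (2 * 2) 2 2 c ∧
      c ∉ divisorClassesSpan (⨁ fun j : Fin N => A (π j)).X (⨁ fun j : Fin N => A (π j)).dim 2 := by
  have hdim : (A b).dim = 3 := by
    have h := Literature.AlgebraicGeometry.Pohlmann1968.finrank_eq_two_mul_dim_of_isCMTypeRealisation (hA b)
    rw [h6] at h
    omega
  have hsep := isSeparatingFamily_of_curves_of_isSimple b h2 hA hni hT (by rw [hdim]; decide)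
  have hnd : IsNondegenerate (Φ b) := isNondegenerate_of_isSimple_of_dim_le_three_slot hA hT (by rw [hdim])
  subst hj₁
  exact exists_exceptional_two_prod_of_ringHom hsep hA π (h2 _ hj₀) h6 hnd e

/-- **The literal fourfold**: two slots `a ≠ b` exhausting `I`, `E = A_a` a CM elliptic curve, `T = A_b` a simple CM
threefold, `e : K_a ↪ K_b`; then `X = E × T = ⨁_{j<2} A_{π j}` (`π = (a, b)`) carries a rational `(2,2)`-class outside
`D²(X) ⊗ ℂ`: `D²(X) ≠ B²(X)`. [cite: MoonenZarhin1999LowDim, Thm. (0.2) (a) and (1)] -/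
theorem exists_exceptional_two_curve_threefold_of_ringHom {a b : I} (hab : a ≠ b) (hI : ∀ i, i = a ∨ i = b)
    (h2 : Module.finrank ℚ (K a) = 2) (h6 : Module.finrank ℚ (K b) = 6)
    (hA : ∀ i, IsCMTypeRealisation (Φ i) (A i) (ι i) (θ i)) (hT : (A b).IsSimple) (e : K a →+* K b) :
    ∃ c : complexBetti (⨁ fun j : Fin 2 => A (![a, b] j)).X (2 * 2), IsRationalClass c ∧
      IsOfHodgeType (⨁ fun j : Fin 2 => A (![a, b] j)).dim (⨁ fun j : Fin 2 => A (![a, b] j)).X (2 * 2) 2 2 c ∧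
      c ∉ divisorClassesSpan (⨁ fun j : Fin 2 => A (![a, b] j)).X (⨁ fun j : Fin 2 => A (![a, b] j)).dim 2 := by
  have h2' : ∀ j, j ≠ b → Module.finrank ℚ (K j) = 2 := fun j hj => by
    rcases hI j with rfl | rfl
    · exact h2
    · exact (hj rfl).elim
  refine exists_exceptional_two_prod_of_ringHom_of_isSimple b h2' h6 hA (fun i j hi hj hij => ?_) hT ![a, b]
    (j₀ := 0) (j₁ := 1) (by exact hab) rfl e
  rcases hI i with rfl | rfl
  · rcases hI j with rfl | rfl
    · exact (hij rfl).elim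
    · exact (hj rfl).elim
  · exact (hi rfl).elim

end Geometry

end Summit.HodgeConjecture.CorCM

end
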